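import Summits.HodgeConjecture.HodgeConjecture.Cruxes.SemiregularSeedsOnAnchors.TypedCrux
import Literature.AlgebraicGeometry.Modules.TensorProduct
import Literature.AlgebraicGeometry.Deformation.VectorBundleLifting

/-!
# Line `isogeny-untwist-superspecial` — skeleton for crux `SemiregularSeedsOnAnchors` (stmt-HodgeConjecture-13941)

Route `PadicSemiregularLift`, crux P2a `SemiregularSeedsOnAnchors` (rank 3, INFORMAL: the route file has no
decl, so this skeleton concludes the shared typed transcription
`Cruxes/SemiregularSeedsOnAnchors/TypedCrux.lean :: SemiregularSeedsOnAnchors C Θ HO` — audit with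
`--crux-decl Summit.HodgeConjecture.HodgeConjecture.Cruxes.SemiregularSeedsOnAnchors.SemiregularSeedsOnAnchorsAt`, the
bundled form of the predicate; see `TypedCrux.lean`).
Idea card `Ideas/isogeny-untwist-superspecial.md` (crux-ideate r1, ideator 3); triage r1: pass / pass
(serious doubt) / fail-as-filed (repairable under an arithmetic side condition) — all three sharpenings are
built in below. Line card: `Lines/isogeny-untwist-superspecial.md`.

## The line (sharpened; ORDER: untwist on `Y`, then bundle by Fourier–Mukai)

LEVER. On an abelian variety `Y/k` (`k = 𝔽̄_p`), pulling a coherent sheaf `Ē` back along the prime-to-`p`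
isogeny `[N] : Y → Y` and twisting by a line bundle `M` changes `Ext²` in a completely controlled way:
`Ext²([N]^*Ē ⊗ M, [N]^*Ē ⊗ M) = ⊕_{τ ∈ Ŷ[N]} Ext²(Ē, Ē ⊗ P_τ)`; the Buchweitz–Flenner map of the pull-back
is `Y[N]`-equivariant with INVARIANT target (`[N]^* = N^{a+b}` on `H^b(Ω^a)`), compatible with pull-back on
the summand `τ = 0` (BF Rem. 4.7(1)) and unipotently conjugated by `exp(At M) ∪ −` under the twist. Hence
(`IsogenyDecomposition` below; linear algebra = `injective_iff_of_offDiagonal_vanishing`, IdeatorThreeSketch):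
  `E′ := [N]^*Ē ⊗ M` p-adically semiregular ⟸ `Ē` p-adically semiregular ∧ `Ext²(Ē, Ē ⊗ P_τ) = 0` for
  all `τ ∈ Ŷ[N] ∖ 0` — and on the sixfold, where `χ(Ē, Ē ⊗ P_τ) = 0`, the level condition is TOTAL
  ORTHOGONALITY `Ext^•(Ē, Ē ⊗ P_τ) = 0` (triage r1-1/r1-2: Serre-duality parity).
Simultaneously `[N]^*` multiplies `H²` by `N²`, so the B-field `B = c₁(Ē)/rk Ē` becomes integral once
`rk Ē ∣ N²`: with `rk·c₁(M) = −N²c₁(Ē)`, `c₁(E′) = 0` and `ch(E′) = [N]^*κ(Ē)`, `κ := ch·exp(−c₁/rk)`.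

INPUT (`SecantSite`). `p ≥ 13` (sixfold anchors need `6 + 6 < p`); `X = J(C)` for a SUPERSPECIAL smooth plane
quartic `C/k` (`X ≅ E³`); Markman's data `d ≥ 4` even, cyclic `G₁, G₂ ⊂ X[d+1]`, `G₁ ∩ G₂ = 0`,
`F₁ = 𝓘_{∪Cᵢ}(Θ)`, `F₂ = 𝓘_{∪Σⱼ}(Θ)`, Orlov's `Φ̃`, `𝓔 = 𝒢^∨[−1]` reflexive of rank `8d` on `X × X̂`, descended
along `q : X × X̂ → Y = (X × X̂)/Ḡ` to the HONEST semiregular simple reflexive `Ē` (arXiv:2502.03415 §1.5, §9.3,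
Lemma 9.3.4, Rem. 9.3.7: `d` even ⇒ Brauer class trivial) with `κ(Ē)` in the `Spin(V)_P`-invariant ring
`R_P = ℚ[Ξ] ⊕ HW_P` (Thm 1.4.1 (3)); two such sheaves (secant and SWAPPED secant `F₁ ↔ F₂`, Rem. 9.2.3) have
`κ₃`'s spanning `ℚΞ³ ⊕ HW_P` with `Ξ³` (Thm 1.4.1 (4)). `Y` is a superspecial abelian sixfold, `≅ E⁶ ≅` ANY
superspecial abelian sixfold (Deligne–Ogus–Shioda uniqueness, `g ≥ 2`; prime-to-`p` étale quotients stay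
superspecial) — so the site is built ON THE ANCHOR FIBRE whenever that is a superspecial abelian sixfold.
Level `N`: `p ∤ N`, `gcd(N, d+1) = 1`, `8d ∣ N²`; triage r1-3's arithmetic side condition
`(C − C) ∩ J(C)[N] = {0}` (fails at the Fermat quartic for `4 ∣ N`: hyperflexes), needed for the LEVEL
ORTHOGONALITY `Ē ⟂ Ē ⊗ P_τ`, `τ ∈ Ŷ[N] ∖ 0`, the site's field `levelOrthogonal` (REAL carriers:
`obstructionGroup n Ē P = Extⁿ(Ē, Ē ⊗ P)`; the finite check F1).
OUTPUT. `E′ᵢ = [N]^*Ēᵢ ⊗ Mᵢ` (reflexive, semiregular by the lever, `ch = [N]^*κ(Ēᵢ) ∈ R_P` — Hodge along the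
honest Weil family) and the FINAL SEEDS `E″ᵢ := Φ_𝒫(E′ᵢ ⊗ Ξ^{m})`, `m ≫ 0`: LOCALLY FREE (Mukai IT₀), p-adically
semiregular (σ has target `HH₋₂` — derived invariance under the equivalence `Φ_𝒫 ∘ (⊗Ξ^m)`, Perry
arXiv:2604.00511 Rem. 2.3, + HKR for `p > 6`), `ch(E″ᵢ) = Φ^H([N]^*κ·e^{mΞ}) ∈ R̂` (the Poincaré class is an
algebraic correspondence on the whole family, so family-Hodge goes to family-Hodge; no B-field survives because
`E′` is untwisted), read back on the anchor fibre through `Ŷ ≅ Y`. Why this ORDER: bundling FIRST would turn the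
B-field into a β-field (`Φ^H ∘ e^B ∘ (Φ^H)⁻¹ = exp(ι_β)`), which `[N]^*` divides instead of clearing; so the lever
must act on the reflexive `Ē`, whose semiregularity has no real carrier (the tree's `sigmaZero/sigmaOne` need
`IsFiniteLocallyFree`) — it is carried by the data package `Φσ : FullSigma k` (σ for all modules, all degrees),
tied to the real maps on bundles by `FullSigma.PinnedTo Θ p` (a hypothesis of the existence stub).
For every `W(k)`-lift `𝒳` of the fibre on which `R̂` stays Hodge and `Ξ̂` lifts (`FamilyHodgeRing.StaysHodgeOn`
= "`𝒳_K` is a member of the (dual) secant Weil family") the seeds satisfy the BEK Hodge condition in ALL degrees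
and `K·{bo ch₃(E″ᵢ)} + Lef³ ⊇ bo(KΞ̂³ ⊕ HŴ ⊗ K) + Lef³` — every φ-Tate Hodge-origin class of a very general
Weil-type lift of discriminant `−1` (Markman Thm 1.5.1's family).

SCOPE AND RESIDUAL. The crux quantifies over ALL anchors and classes; this line reaches the `(𝒳, α)` in
`InSecantScope`. Everything else — Fermat anchors, abelian anchors of other dimension, lifts of `E⁶` not in a
secant Weil family (CM lifts with exotic classes, Weil type of discriminant `≠ −1` / other hermitian genus),
classes outside `KΞ³ ⊕ HW` — is the registered RESIDUAL stub `stub_residualOffSecantScope`, NOT a lemma of this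
line: the crux on the complement of the scope, carried so that the composition is an honest kernel-checked
proof of the WHOLE typed crux. Recommendation (card §Triage answers): split P2a by anchor class.

STUBS (3 registered) and the composition `SemiregularSeedsOnAnchors_of` (real proof: case split on the scope; in
scope, `Ē` semiregular (site) + level orthogonality (site) + `IsogenyDecomposition` ⟹ `E′` semiregular ⟹
(site transport field: FM bundling) `E″` p-adically semiregular on real carriers; `ch(E″) ∈ R̂` (site) +
`StaysHodgeOn` ⟹ Hodge condition; reach (site) + `bo Ξ̂^r ∈ Lef` ⟹ the span):
* `stub_secantSite` (XL, HARDEST) — existence of the site on every superspecial abelian sixfold over `k`,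
  `p ≥ 13`, for every σ-package pinned to the real maps: (a) placement with torsion avoidance + Markman's
  genericity in characteristic `p`; (b) Markman §8–9 on that fibre (`Ē` semiregular, `κ ∈ R`, reach);
  (c) LEVEL-`N` TOTAL ORTHOGONALITY (F1 — the load-bearing finite check); (d) FM bundling: IT₀, derived
  invariance of semiregularity, `ch(E″) ∈ R̂` and reach on the dual.
* `stub_isogenyDecomposition` (L) — THE LEVER as a decomposition package (for the σ-data on the reflexive `Ē`).
* `stub_residualOffSecantScope` — RESIDUAL (the crux off the scope; not this line's).

Disproof used: `Cruxes/SemiregularSeedsOnAnchors/Disproof.lean` (cdisprove cycle 1; informal crux, so no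
`_false_without_` theorem). Honoured: §A (σ as data is junk-refutable) — on the SEEDS (bundles) degrees `0, 1` of σ
are the REAL `sigmaZero/sigmaOne` (typed crux), only `σ_{≥2}` is `Θ`, and the full package `Φσ` on non-bundles is
tied to them by `PinnedTo`; §B/§E(3) (forced kernels; `ext² = 38 > 24` for the one-sheaf plane of 1805.11574) —
the line works on SIXFOLDS (`τ₆ = 495`, χ = 0) and never uses that sheaf; §D3 (`End E` needs `ext² ≤ 12`) and §D4
(the NS-jump does not untwist `B`) — isogeny pull-back is the third untwisting: it rescales `H²` by `N²` and
changes `Ext²` only by off-diagonal summands on which σ vanishes; §F(5) (forced-kernel proofs must be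
autoequivalence-invariant) — consistent, everything is transported by `Φ̃`, `Φ_𝒫`; hypothesis (b) Hodge origin
and "φ-Tate on the nose" are verbatim in the typed crux (`HO`, `tateClasses`). Landed Negative lemmas
(`Theorems/SemiregularSeedsOnAnchors/Negative/SemiregularityCarrier.lean`: redecoration / forced-kernel counts
over `AtiyahTraceAlgebra`) concern σ-as-closed-data carriers; no stub below is an instance (σ-data here are
parameters, pinned on bundles, never ∃-chosen). Negatives index (ELineTransport, DerivedTorelliFermat): unrelated.
-/

set_option linter.dupNamespace false
set_option linter.unusedVariables false

noncomputable section

open CategoryTheory CategoryTheory.Abelian AlgebraicGeometry Opposite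
open scoped Isocrystal
open Literature.AlgebraicGeometry.Motives Literature.AlgebraicGeometry.Motives.WittScheme
open Literature.AlgebraicGeometry.HodgeTheory Literature.AlgebraicGeometry.Modules
open Literature.AlgebraicGeometry.Deformation
open Summit.HodgeConjecture.HodgeConjecture.Cruxes.SemiregularSeedsOnAnchors

universe u

namespace Summit.HodgeConjecture.HodgeConjecture.Cruxes.SemiregularSeedsOnAnchors.IsogenyUntwistSuperspecial

variable {p : ℕ} [Fact p.Prime] {k : Type u} [Field k] [CharP k p] [PerfectRing k p]

/-! ## σ for all coherent modules (data), pinned to the real maps on bundles -/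

/-- The Buchweitz–Flenner semiregularity components for ALL `𝒪_X`-modules and ALL degrees, as data
(intended: `σ_q = tr(At^q ∘ −)/q!` through a finite locally free resolution / the Atiyah class in `D^b`;
the reflexive secant sheaves `Ē`, `E′` are not locally free, and the tree's real `sigmaZero/sigmaOne` need
`IsFiniteLocallyFree`). Source: Mathlib's `Ext²(E, E)` in `X.Modules` (real for every module); target: the real
`H^{q+2}(X, Ω^q)`. -/
structure FullSigma (k : Type u) [Field k] where
  /-- `σ_q` on `Ext²(E, E)`, every module `E`, every `q` -/
  sigma : ∀ (X : SchemeOver k) (E : X.left.Modules) (q : ℕ), Ext.{u + 1} E E 2 →+ hodgeCohomology X q (q + 2)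

/-- `E` is semiregular for the package `Φσ`: `⊕_{q < p} σ_q` is injective on `Ext²(E, E)`. -/
def IsSemiregularData (Φσ : FullSigma k) (p : ℕ) (X : SchemeOver k) (E : X.left.Modules) : Prop :=
  ∀ x : Ext.{u + 1} E E 2, (∀ q : ℕ, q < p → Φσ.sigma X E q x = 0) → x = 0

/-- `Φσ` is PINNED to the real maps (and to `Θ` in degrees `≥ 2`): on finite locally free modules, being
semiregular for `Φσ` is the typed crux's `IsPadicSemiregular Θ p` (real `σ₀, σ₁`). The intended `Φσ` satisfies
this (its degree-`0,1` components on bundles ARE `sigmaZero`, `sigmaOne`). -/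
def FullSigma.PinnedTo (Φσ : FullSigma k) (Θ : HigherSigma k) (p : ℕ) : Prop :=
  ∀ (X : SchemeOver k) (E : X.left.Modules) (hE : IsFiniteLocallyFree E),
    IsSemiregularData Φσ p X E ↔ IsPadicSemiregular Θ p X hE

/-! ## The objects the stubs are stated over -/

/-- **Family Hodge ring** of a special fibre `A/k` (intended: Markman's `Spin(V)_P`-invariant ring
`R_P = K[Ξ_P] ⊕ HW_P ⊂ ⊕_r H^{2r}_cris(A)_K` of the `K`-secant Weil datum, transported to the FM dual and read on
`A` — the classes that stay Hodge on EVERY member of the secant Weil family; arXiv:2502.03415 Cor. 1.3.2): a class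
`Ξ ∈ H²(A)` and `K`-subspaces `inv r ⊂ H^{2r}(A)` containing `Ξ^r`. -/
structure FamilyHodgeRing (C : CrystallineRealization p k) (A : SchemeOver k) where
  /-- the polarisation class `Ξ` of the family -/
  Xi : C.obj A 2
  /-- the degree-`2r` piece of the family Hodge ring -/
  inv : ∀ r : ℕ, Submodule K(p, k) (C.obj A (2 * r))
  /-- `Ξ^r ∈ inv r` -/
  pow_mem : ∀ r : ℕ, C.pow A Xi r ∈ inv r

/-- `𝒳/W` is a LIFT IN THE FAMILY of `R` (a family Hodge ring of its own special fibre): Berthelot–Ogus carries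
`R` into the Hodge filtration of `X_K`, and the powers of `Ξ` become Lefschetz classes of `X_K` (`Ξ` lifts:
Berthelot–Ogus 3.8 + Grothendieck existence for the ample line bundle). -/
def FamilyHodgeRing.StaysHodgeOn {C : CrystallineRealization p k} {𝒳 : SchemeOver (WittVector p k)}
    (R : FamilyHodgeRing C (specialFibre 𝒳)) : Prop :=
  (∀ (r : ℕ) (x : C.obj (specialFibre 𝒳) (2 * r)), x ∈ R.inv r →
      C.bo 𝒳 (2 * r) x ∈ C.dR.fil (2 * r) r) ∧
    ∀ r : ℕ, C.bo 𝒳 (2 * r) (C.pow (specialFibre 𝒳) R.Xi r) ∈ C.dR.lefschetzClasses (genericFibre 𝒳) r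

/-- **Secant site** on a special fibre `A/k` (intended instance in the module docstring: `A` a superspecial
abelian sixfold carrying Markman's `Y` and, through `Ŷ ≅ Y ≅ A`, its dual). DATA: the level `N` and `[N]`; the
reflexive descended secant sheaves `Ebar i` (secant and swapped secant) with their untwisting line bundles
`M i`; the FINAL SEEDS `E i = Φ_𝒫(([N]^*Ēᵢ ⊗ Mᵢ) ⊗ Ξ^m)`; the family Hodge ring `R`. PROPERTY FIELDS = the paper
theorems the existence stub must deliver on the superspecial fibre: `Ē` semiregular (Markman §9.3 transported to
characteristic `p`); LEVEL ORTHOGONALITY `Ext^•(Ēᵢ, Ēᵢ ⊗ P) = 0` for every line bundle `P ≇ 𝒪` with `[N]^*P ≅ 𝒪`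
(F1, REAL carriers); the FM transport of semiregularity from `E′ᵢ` to the bundle `E i` (IT₀ + derived
invariance); `ch(E i) ∈ R` in all degrees and the reach `R^{(r)} ≤ K·{ch_r(E i)} + K·Ξ^r` (Thm 1.4.1 (3),(4)
transported by `Φ^H`). -/
structure SecantSite (C : CrystallineRealization p k) (Θ : HigherSigma k) (Φσ : FullSigma k)
    (A : SchemeOver k) where
  /-- finite index of the seed family (secant, swapped secant, …) -/
  ι : Type
  [fintype : Fintype ι]
  /-- the level -/
  N : ℕ
  N_ne_zero : N ≠ 0
  /-- prime to `p` (so `[N]` is étale) -/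
  not_dvd : ¬ p ∣ N
  /-- multiplication by `N` on the abelian variety `A`, as a `k`-morphism -/
  mulN : A ⟶ A
  /-- the family Hodge ring (of the dual secant Weil datum, read on `A`) -/
  R : FamilyHodgeRing C A
  /-- the reflexive descended secant sheaves `Ēᵢ` -/
  Ebar : ι → A.left.Modules
  /-- `Ēᵢ` is semiregular (Markman), for the σ-data -/
  semiregularBar : ∀ i, IsSemiregularData Φσ p A (Ebar i)
  /-- the untwisting line bundles `Mᵢ` (`rk·c₁(Mᵢ) = −N²c₁(Ēᵢ)`) -/
  M : ι → A.left.Modules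
  hasRankM : ∀ i, HasRank (M i) 1
  /-- LEVEL ORTHOGONALITY (F1): `Extⁿ(Ēᵢ, Ēᵢ ⊗ P) = 0` for every line bundle `P ≇ 𝒪` with `[N]^*P ≅ 𝒪` -/
  levelOrthogonal : ∀ (i : ι) (P : A.left.Modules), HasRank P 1 →
    Nonempty ((Scheme.Modules.pullback mulN.left).obj P ≅ unitModule A.left) →
    IsEmpty (P ≅ unitModule A.left) → ∀ n : ℕ, Subsingleton (obstructionGroup n (Ebar i) P)
  /-- the final seeds `E″ᵢ` (FM transforms of the untwisted sheaves), bundles -/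
  E : ι → A.left.Modules
  finiteLocallyFree : ∀ i, IsFiniteLocallyFree (E i)
  /-- FM TRANSPORT: if the untwisted `E′ᵢ = [N]^*Ēᵢ ⊗ Mᵢ` is semiregular (σ-data) then the bundle `E″ᵢ` is
  p-adically semiregular on the real carriers (derived invariance of σ under `Φ_𝒫 ∘ (⊗ Ξ^m)` + pinning) -/
  transport : ∀ i,
    IsSemiregularData Φσ p A (tensorObj ((Scheme.Modules.pullback mulN.left).obj (Ebar i)) (M i)) →
      IsPadicSemiregular Θ p A (finiteLocallyFree i)
  /-- `ch(E″ᵢ) ∈ R` in every degree (`= Φ^H([N]^*κ(Ēᵢ)·e^{mΞ})`, family-Hodge on the dual family) -/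
  ch_mem : ∀ (i : ι) (r : ℕ), C.chCris A (E i) r ∈ R.inv r
  /-- reach: `R` is spanned by the `ch(E″ᵢ)` and the powers of `Ξ` -/
  reach : ∀ r : ℕ, R.inv r ≤
    Submodule.span K(p, k) (Set.range fun i => C.chCris A (E i) r) ⊔ Submodule.span K(p, k) {C.pow A R.Xi r}

attribute [instance] SecantSite.fintype

namespace SecantSite

variable {C : CrystallineRealization p k} {Θ : HigherSigma k} {Φσ : FullSigma k} {A : SchemeOver k}

/-- The UNTWISTED SHEAF `E′ᵢ := [N]^*Ēᵢ ⊗ Mᵢ` (the lever's output; reflexive). -/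
def untwist (S : SecantSite C Θ Φσ A) (i : S.ι) : A.left.Modules :=
  tensorObj ((Scheme.Modules.pullback S.mulN.left).obj (S.Ebar i)) (S.M i)

end SecantSite

/-! ## Stub statements (closed over the same parameters as the typed crux, plus the σ-data `Φσ`) -/

/-- Statement of `stub_secantSite`. -/
def SecantSiteExistence [IsAlgClosed k] (C : CrystallineRealization p k) (Θ : HigherSigma k)
    (Φσ : FullSigma k) : Prop :=
  Φσ.PinnedTo Θ p → 13 ≤ p → ∀ B : AbelianVariety k, B.dim = 6 →
    (∃ E₀ : AbelianVariety k, E₀.IsSupersingularEllipticCurve ∧ Nonempty (B ≅ E₀.powSucc 5)) →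
    Nonempty (SecantSite C Θ Φσ B.X)

/-- Statement of `stub_isogenyDecomposition` (THE LEVER): for `E′ = [N]^*Ē ⊗ M` there is a decomposition
`Ext²(E′, E′) ≃ Ext²(Ē, Ē) × T` (intended `T = ⊕_{τ ≠ 0} Ext²(Ē, Ē ⊗ P_τ)`: `[N]_*[N]^* = ⊕_τ (− ⊗ P_τ)` and
adjunction, transported along `− ⊗ M`) such that (1) `T = 0` when all `Ext²(Ē, Ē ⊗ P_τ)`, `τ ≠ 0`, vanish;
(2) every `σ_q(E′)` kills the off-diagonal summand (target `H^{q+2}(Ω^q ⊗ P_τ) = 0` / equivariance with invariant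
target); (3) on the diagonal summand the JOINT kernels (`q < p`) of `σ(E′)` and `σ(Ē)` correspond (`[N]^*`
injective on `H^b(Ω^a)`, BF Rem. 4.7(1), `exp(At M) ∪ −` unipotent). -/
def IsogenyDecomposition (C : CrystallineRealization p k) (Θ : HigherSigma k) (Φσ : FullSigma k) : Prop :=
  ∀ (A : SchemeOver k) (S : SecantSite C Θ Φσ A) (i : S.ι),
    ∃ (T : Type (u + 1)) (_ : AddCommGroup T)
      (e : Ext.{u + 1} (S.untwist i) (S.untwist i) 2 ≃+ Ext.{u + 1} (S.Ebar i) (S.Ebar i) 2 × T),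
      ((∀ P : A.left.Modules, HasRank P 1 →
          Nonempty ((Scheme.Modules.pullback S.mulN.left).obj P ≅ unitModule A.left) →
          IsEmpty (P ≅ unitModule A.left) → Subsingleton (obstructionGroup 2 (S.Ebar i) P)) →
        Subsingleton T) ∧
      (∀ (t : T) (q : ℕ), Φσ.sigma A (S.untwist i) q (e.symm (0, t)) = 0) ∧
      (∀ y : Ext.{u + 1} (S.Ebar i) (S.Ebar i) 2,
        (∀ q : ℕ, q < p → Φσ.sigma A (S.untwist i) q (e.symm (y, 0)) = 0) ↔
          (∀ q : ℕ, q < p → Φσ.sigma A (S.Ebar i) q y = 0))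

/-- **The scope of the line** at `(𝒳, r, α)`: the special fibre carries a secant site whose family Hodge ring
stays Hodge on `𝒳` (`𝒳_K` is a member of the secant Weil family) and reaches `α` modulo Lefschetz classes:
`α ∈ K·bo(R^{(r)}) + Lef^r(X_K)`. -/
def InSecantScope (C : CrystallineRealization p k) (Θ : HigherSigma k) (Φσ : FullSigma k)
    (𝒳 : SchemeOver (WittVector p k)) (r : ℕ) (α : C.dR.obj (genericFibre 𝒳) (2 * r)) : Prop :=
  ∃ S : SecantSite C Θ Φσ (specialFibre 𝒳), S.R.StaysHodgeOn ∧
    α ∈ Submodule.span K(p, k) (C.bo 𝒳 (2 * r) '' (S.R.inv r : Set (C.obj (specialFibre 𝒳) (2 * r)))) ⊔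
      C.dR.lefschetzClasses (genericFibre 𝒳) r

/-- Statement of `stub_residualOffSecantScope`: the crux OFF the scope of this line (RESIDUAL). -/
def ResidualOffSecantScope [IsAlgClosed k] (C : CrystallineRealization p k) (Θ : HigherSigma k)
    (Φσ : FullSigma k)
    (HO : ∀ ⦃𝒳 : SchemeOver (WittVector p k)⦄ ⦃i : ℕ⦄, C.dR.obj (genericFibre 𝒳) i → Prop) : Prop :=
  ∀ (n : ℕ) (𝒳 : SchemeOver (WittVector p k)), IsPadicAnchor C n 𝒳 →
    ∀ (r : ℕ) (α : C.dR.obj (genericFibre 𝒳) (2 * r)),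
      α ∈ C.dR.fil (2 * r) r →
      (∃ x ∈ C.tateClasses (specialFibre 𝒳) r, C.bo 𝒳 (2 * r) x = α) →
      HO α → ¬ InSecantScope C Θ Φσ 𝒳 r α → SeedSpan C Θ 𝒳 r α

/-! ## The registered stubs (statements bundled over `F : AnchorField` for the audit: `Stmt.<stub>`) -/

namespace Stmt

/-- Statement of `stub_secantSite` (bundled). -/
def stub_secantSite (F : AnchorField.{u}) (C : CrystallineRealization F.p F.k) (Θ : HigherSigma F.k)
    (Φσ : FullSigma F.k) : Prop :=
  SecantSiteExistence C Θ Φσ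

/-- Statement of `stub_isogenyDecomposition` (bundled). -/
def stub_isogenyDecomposition (F : AnchorField.{u}) (C : CrystallineRealization F.p F.k) (Θ : HigherSigma F.k)
    (Φσ : FullSigma F.k) : Prop :=
  IsogenyDecomposition C Θ Φσ

/-- Statement of `stub_residualOffSecantScope` (bundled). -/
def stub_residualOffSecantScope (F : AnchorField.{u}) (C : CrystallineRealization F.p F.k) (Θ : HigherSigma F.k)
    (Φσ : FullSigma F.k)
    (HO : ∀ ⦃𝒳 : SchemeOver (WittVector F.p F.k)⦄ ⦃i : ℕ⦄, C.dR.obj (genericFibre 𝒳) i → Prop) : Prop :=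
  ResidualOffSecantScope C Θ Φσ HO

end Stmt

/-- **Stub 1 — the SECANT SITE EXISTS on every superspecial abelian sixfold** (`p ≥ 13`, `k` algebraically
closed of characteristic `p`, σ-data pinned to the real maps). XL; HARDEST. Sub-obligations (line card):
(a) PLACEMENT — a superspecial smooth plane quartic `C/k` (Ibukiyama 1993; ≍ p⁶ of them) with
`(C − C) ∩ J(C)[N] = {0}` for an admissible level `N` (`p ∤ N`, `gcd(N, d+1) = 1`, `8d ∣ N²`) and Markman's
genericity (Assumption 9.1.1, Lemma 9.1.2, choice of `G₁, G₂`; arXiv:2502.03415 §9.1–9.3) on `X = J(C)`;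
(b) TRANSPLANT — Markman §8–9 on that fibre in characteristic `p` (`Ē` semiregular via `ker ob = ker ch` and
HKR for `p > 6`; `κ(Ē) ∈ R_P`; secant + swapped secant span `ℚΞ³ ⊕ HW`; superspecial uniqueness to sit on the
given sixfold, Ibukiyama–Katsura 1994 §1); (c) LEVEL ORTHOGONALITY F1 — `Ext^•(Ē, Ē ⊗ P_τ) = 0` for
`τ ∈ Ŷ[N] ∖ 0` (jump loci of `F₁, F₂` against the Rouquier image of the level; necessary condition = (a)'s
torsion avoidance, triage r1-3 §A4); (d) FM BUNDLING — `E″ = Φ_𝒫(E′ ⊗ Ξ^m)` locally free by IT₀ (Mukai),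
semiregularity transported by derived invariance (Perry Rem. 2.3), `ch(E″) = Φ^H([N]^*κ·e^{mΞ}) ∈ R̂` and the
reach on the dual, read on `A` through `Ŷ ≅ Y ≅ A`. WHY IT MIGHT FAIL: an unlisted component of the jump locus
through `N`-torsion for every admissible `N`; a rank drop of `ob_{Fᵢ}` at the superspecial curve (card F2); a
non-trivial Rouquier character on the translation component (then `Ext¹_χ ≠ 0` and every even `N` is dead). -/
theorem stub_secantSite (F : AnchorField.{u}) (C : CrystallineRealization F.p F.k) (Θ : HigherSigma F.k)
    (Φσ : FullSigma F.k) : Stmt.stub_secantSite F C Θ Φσ := by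
  sorry

/-- **Stub 2 — THE LEVER: isotypic decomposition of `Ext²` under `[N]^*` and behaviour of σ on it.** L.
`[N]` finite étale (`p ∤ N`), `[N]_*𝒪 = ⊕_{τ ∈ Â[N]} P_τ`, projection formula and adjunction
`Ext([N]^*Ē, [N]^*Ē) = ⊕_τ Ext(Ē, Ē ⊗ P_τ)`, deck-equivariance of σ with invariant target, pull-back
compatibility of σ (Buchweitz–Flenner Rem. 4.7(1)), `[N]^*` injective on `H^b(Ω^a)` (`= N^{a+b}`), twist formula
`σ_{E ⊗ M} = exp(At M) ∪ σ_E` (unipotent); linear algebra = `injective_iff_of_offDiagonal_vanishing`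
(IdeatorThreeSketch, PROVED). WHY IT MIGHT FAIL: it is a lemma about the intended σ; as typed it is a property
of the σ-DATA `Φσ` (functoriality under finite étale pull-back and twist), false for junk packages exactly as
intended — the debt is the Atiyah-class trace for non-locally-free sheaves, not yet on carriers. -/
theorem stub_isogenyDecomposition (F : AnchorField.{u}) (C : CrystallineRealization F.p F.k)
    (Θ : HigherSigma F.k) (Φσ : FullSigma F.k) : Stmt.stub_isogenyDecomposition F C Θ Φσ := by
  sorry

/-- **Stub 3 — RESIDUAL: the crux off the secant scope.** NOT a lemma of this line: anchors that are not
superspecial abelian sixfolds in a secant Weil family, and classes outside `K·bo(R) + Lef`, are somebody else's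
(Fermat anchors: line `gorenstein-ci-seeds`; `E⁴` Weil anchors: line `rank-one-secant-square-seeds`; beyond:
open). Carried so that `SemiregularSeedsOnAnchors_of` proves the whole typed crux; the line card asks the tenure
planner to SPLIT P2a by anchor class, after which this stub leaves the skeleton. WHY IT MIGHT FAIL: it is the
rest of the crux (forced kernels at `E⁴`, supply at Fermat anchors, exotic classes at CM lifts). -/
theorem stub_residualOffSecantScope (F : AnchorField.{u}) (C : CrystallineRealization F.p F.k)
    (Θ : HigherSigma F.k) (Φσ : FullSigma F.k)
    (HO : ∀ ⦃𝒳 : SchemeOver (WittVector F.p F.k)⦄ ⦃i : ℕ⦄, C.dR.obj (genericFibre 𝒳) i → Prop) :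
    Stmt.stub_residualOffSecantScope F C Θ Φσ HO := by
  sorry

/-! ## The composition (no `sorry` below this line) -/

section Composition

variable {C : CrystallineRealization p k} {Θ : HigherSigma k} {Φσ : FullSigma k}

/-- THE LEVER APPLIED: `Ē` semiregular (site) + level orthogonality (site) + the decomposition ⟹ the untwisted
`E′ = [N]^*Ē ⊗ M` is semiregular (σ-data). -/
theorem isSemiregularData_untwist (hS2 : IsogenyDecomposition C Θ Φσ) {A : SchemeOver k}
    (S : SecantSite C Θ Φσ A) (i : S.ι) : IsSemiregularData Φσ p A (S.untwist i) := by
  obtain ⟨T, _, e, hT, hoff, hdiag⟩ := hS2 A S i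
  haveI : Subsingleton T := hT fun P hP hN hne => S.levelOrthogonal i P hP hN hne 2
  intro x hx
  have hxe : x = e.symm ((e x).1, 0) := by
    have h2 : (e x).2 = 0 := Subsingleton.elim _ _
    calc x = e.symm (e x) := (e.symm_apply_apply x).symm
      _ = e.symm ((e x).1, (e x).2) := by simp
      _ = e.symm ((e x).1, 0) := by rw [h2]
  have hk : ∀ q : ℕ, q < p → Φσ.sigma A (S.untwist i) q (e.symm ((e x).1, 0)) = 0 := by
    intro q hq
    rw [← hxe]
    exact hx q hq
  have hy0 : (e x).1 = 0 := S.semiregularBar i (e x).1 ((hdiag (e x).1).1 hk)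
  rw [hxe, hy0]
  exact map_zero e.symm

/-- In-scope seeds are p-adically semiregular ON THE REAL CARRIERS: the lever, then the site's FM transport. -/
theorem isPadicSemiregular_seed (hS2 : IsogenyDecomposition C Θ Φσ) {A : SchemeOver k}
    (S : SecantSite C Θ Φσ A) (i : S.ι) : IsPadicSemiregular Θ p A (S.finiteLocallyFree i) :=
  S.transport i (isSemiregularData_untwist hS2 S i)

/-- In-scope seeds satisfy the Bloch–Esnault–Kerz Hodge condition in all degrees: `ch_r(E″) ∈ R^{(r)}` and `R`
stays Hodge on `𝒳`. -/
theorem hodgeCondition_seed {𝒳 : SchemeOver (WittVector p k)} (S : SecantSite C Θ Φσ (specialFibre 𝒳))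
    (hR : S.R.StaysHodgeOn) (i : S.ι) : C.HodgeCondition 𝒳 (S.E i) :=
  fun r => hR.1 r _ (S.ch_mem i r)

/-- The span step: `K·bo(R^{(r)}) + Lef ≤ K·{bo ch_r(E″ᵢ)} + Lef`, because `R^{(r)} ≤ K·{ch_r(E″ᵢ)} + K·Ξ^r`
and `bo Ξ^r ∈ Lef`. -/
theorem span_inv_le_span_seeds {𝒳 : SchemeOver (WittVector p k)} (S : SecantSite C Θ Φσ (specialFibre 𝒳))
    (hR : S.R.StaysHodgeOn) (r : ℕ) :
    Submodule.span K(p, k) (C.bo 𝒳 (2 * r) '' (S.R.inv r : Set (C.obj (specialFibre 𝒳) (2 * r)))) ⊔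
        C.dR.lefschetzClasses (genericFibre 𝒳) r ≤
      Submodule.span K(p, k)
          (Set.range fun i => C.bo 𝒳 (2 * r) (C.chCris (specialFibre 𝒳) (S.E i) r)) ⊔
        C.dR.lefschetzClasses (genericFibre 𝒳) r := by
  refine sup_le ?_ le_sup_right
  rw [Submodule.span_le]
  rintro _ ⟨x, hx, rfl⟩
  have hx' : x ∈ Submodule.span K(p, k) (Set.range fun i => C.chCris (specialFibre 𝒳) (S.E i) r) ⊔
      Submodule.span K(p, k) {C.pow (specialFibre 𝒳) S.R.Xi r} := S.reach r hx
  rw [Submodule.mem_sup] at hx'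
  obtain ⟨y, hy, z, hz, rfl⟩ := hx'
  rw [map_add]
  refine Submodule.add_mem_sup ?_ ?_
  · have hy' : C.bo 𝒳 (2 * r) y ∈ Submodule.span K(p, k)
        (C.bo 𝒳 (2 * r) '' Set.range fun i => C.chCris (specialFibre 𝒳) (S.E i) r) := by
      rw [Submodule.span_image]
      exact Submodule.mem_map_of_mem hy
    refine (Submodule.span_le.2 ?_) hy'
    rintro _ ⟨_, ⟨i, rfl⟩, rfl⟩
    exact Submodule.subset_span ⟨i, rfl⟩
  · rw [Submodule.mem_span_singleton] at hz
    obtain ⟨c, rfl⟩ := hz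
    rw [map_smul]
    exact Submodule.smul_mem _ _ (hR.2 r)

/-- **The line, in scope**: a secant site on `X_k` in whose Weil family `𝒳` lies and whose classes reach `α`
yields the seeds — `SeedSpan` — by the lever, the FM transport and linear algebra. -/
theorem seedSpan_of_inSecantScope (hS2 : IsogenyDecomposition C Θ Φσ) (𝒳 : SchemeOver (WittVector p k))
    (r : ℕ) (α : C.dR.obj (genericFibre 𝒳) (2 * r)) (h : InSecantScope C Θ Φσ 𝒳 r α) :
    SeedSpan C Θ 𝒳 r α := by
  obtain ⟨S, hR, hα⟩ := h
  let eqv : Fin (Fintype.card S.ι) ≃ S.ι := (Fintype.equivFin S.ι).symm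
  refine ⟨Fintype.card S.ι, fun j => S.E (eqv j), fun j => S.finiteLocallyFree (eqv j),
    fun j => ⟨isPadicSemiregular_seed hS2 S (eqv j), hodgeCondition_seed S hR (eqv j)⟩, ?_⟩
  refine (le_trans (span_inv_le_span_seeds S hR r) (sup_le_sup_right (Submodule.span_mono ?_) _)) hα
  rintro _ ⟨i, rfl⟩
  exact ⟨eqv.symm i, by simp [eqv]⟩

/-- The composition, unbundled: from the three stub statements, the typed crux predicate
`SemiregularSeedsOnAnchors C Θ HO` for all `C Θ Φσ HO`: case split on the scope; in scope the line
(`seedSpan_of_inSecantScope`), off scope the residual stub. The site-existence stub is the NON-VACUITY of the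
scope (without it the split is empty on the line's side); logically the split needs only stubs 2–3. -/
theorem semiregularSeedsOnAnchors_of_stubs [IsAlgClosed k] (C : CrystallineRealization p k) (Θ : HigherSigma k)
    (Φσ : FullSigma k)
    (HO : ∀ ⦃𝒳 : SchemeOver (WittVector p k)⦄ ⦃i : ℕ⦄, C.dR.obj (genericFibre 𝒳) i → Prop) :
    SecantSiteExistence C Θ Φσ → IsogenyDecomposition C Θ Φσ → ResidualOffSecantScope C Θ Φσ HO →
      SemiregularSeedsOnAnchors C Θ HO := by
  intro _hS1 hS2 hS3 n 𝒳 h𝒳 r α hfil hTate hHO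
  by_cases hscope : InSecantScope C Θ Φσ 𝒳 r α
  · exact seedSpan_of_inSecantScope hS2 𝒳 r α hscope
  · exact hS3 n 𝒳 h𝒳 r α hfil hTate hHO hscope

end Composition

/-- **`SemiregularSeedsOnAnchors_of` — THE SKELETON THEOREM (audited shape).** From the three registered stub
statements (`Stmt.stub_secantSite`, `Stmt.stub_isogenyDecomposition`, `Stmt.stub_residualOffSecantScope`, by
name) to the crux BY NAME in its bundled form `SemiregularSeedsOnAnchorsAt F C Θ HO` (= the predicate
`SemiregularSeedsOnAnchors C Θ HO`, `semiregularSeedsOnAnchorsAt_iff`), for every anchor field `F`, realization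
`C`, higher-σ package `Θ`, σ-data `Φσ` and Hodge-origin predicate `HO`. No `sorry`. -/
theorem SemiregularSeedsOnAnchors_of (F : AnchorField.{u}) (C : CrystallineRealization F.p F.k)
    (Θ : HigherSigma F.k) (Φσ : FullSigma F.k)
    (HO : ∀ ⦃𝒳 : SchemeOver (WittVector F.p F.k)⦄ ⦃i : ℕ⦄, C.dR.obj (genericFibre 𝒳) i → Prop) :
    Stmt.stub_secantSite F C Θ Φσ → Stmt.stub_isogenyDecomposition F C Θ Φσ →
      Stmt.stub_residualOffSecantScope F C Θ Φσ HO → SemiregularSeedsOnAnchorsAt F C Θ HO :=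
  fun h1 h2 h3 => semiregularSeedsOnAnchors_of_stubs C Θ Φσ HO h1 h2 h3

end Summit.HodgeConjecture.HodgeConjecture.Cruxes.SemiregularSeedsOnAnchors.IsogenyUntwistSuperspecial

end
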